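import Summits.BirchSwinnertonDyer.BirchSwinnertonDyer.Theorems.Rank1ResidualJetUnramifiedCoboundaryE0
import Summits.BirchSwinnertonDyer.BirchSwinnertonDyer.Theorems.Rank1ResidualJetUnramifiedNodeLiftE0
import Summits.BirchSwinnertonDyer.BirchSwinnertonDyer.Theorems.Rank1ResidualJetUnramifiedCuspLiftE0
import Summits.BirchSwinnertonDyer.Rank1Residual.X11b.NeronIdentityReceptacle
import HarnessLib

/-!
# T1 JET (cell `bsd-jet`), road K, K-GAP-2 (`h49str`), step (A4): STRONG Milne *ADT* I.3.8 at a bad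
# place — an unramified `E⁰(K̄_v)`-valued crossed homomorphism is the coboundary of a point OF
# `E⁰(K̄_v)` (`X11b.E0Receptacle`)

HONEST FRAMING (programme file §HONESTY, verbatim): «no tranche here proves BSD; ARM L moves the
LITERAL column of an r ≤ 1 census into the kernel-proved-modulo-named-print column.» THEOREMS ONLY
(seat `bsd-jet-pv-1`, session g7; `--supports stmt-BirchSwinnertonDyer-14418`, helper); 0 classes
move. WHAT THIS IS. x11b3's `GrossBadPlace.oneCocycleClass_eq_zero_of_mem_E0Receptacle` (the input
(α) of Gross 1991 Prop. 6.2 (1) at a bad place: an `E⁰(K̄_v)`-valued continuous crossed homomorphism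
`Γ_{K_v} → E(K̄_v)` vanishing on the inertia group has trivial class, "`H¹(K_v^{ur}/K_v, E⁰) = 0`
[M; I 3.8]") in its STRONG form, the one Jetchev's stringent condition needs (Prop. 4.1 / 4.9:
"the map `E⁰(K_v) → H¹(K_v^{ur}/K_v, E⁰[p^m])` is surjective", i.e. the coboundary is witnessed IN
`E⁰`): **`f = ∂S` with `S ∈ E0Receptacle X v`**. Assembly of the `E₀`-tracking re-runs of
x11b3-p8's chain (steps A1–A3: `exists_lift_sub_mem_kernel_of_has{Multiplicative,Additive}ReductionAt_mem`,
`exists_mem_eq_map_sub_of_cocycle_of_lift`) along the receptacle's equivariant transport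
`Φ : E(K̄_v) ≃ V(K̄_v)` (the same assembly as x11b3-p8's `UnramifiedNode.oneCocycleClass_eq_zero_of_…_of_forall`).
Multiplicative and additive places (the places over the carrier `q ∣ N`); no new mathematics.
References: [cite: MilneADT2006, Ch. I Prop. 3.8] [cite: Jetchev2008, Prop. 4.1 (pp. 819–821), Prop. 4.9]
[cite: GrossLMS1991, Prop. 6.2 (1), p. 244] [cite: SilvermanAEC2009, VII.5 Prop. 5.1].
-/

set_option autoImplicit false

noncomputable section

open scoped Classical NNReal Topology

namespace Summit.BirchSwinnertonDyer.Rank1Residual.JET.StrongMilne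

open WeierstrassCurve Literature.NumberTheory.EllipticCurves
  Literature.NumberTheory.EllipticCurves.FormalGroupChart
  Literature.NumberTheory.GaloisRepresentations NumberField IsDedekindDomain Field
  Literature.NumberTheory.GaloisRepresentations.IsNonarchimedeanLocalField IsDedekindDomain.HeightOneSpectrum
  Summit.BirchSwinnertonDyer.Rank1Residual.X11b.Three.UnramifiedNode
  Summit.BirchSwinnertonDyer.Rank1Residual.X11b

universe u

variable {K : Type u} [Field K] [NumberField K]

set_option maxHeartbeats 800000 in
/-- **Strong Milne *ADT* I.3.8 at a bad place: the coboundary witness lies in `E⁰(K̄_v)`.** For `X/K`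
elliptic with BAD reduction at `v` (multiplicative or additive), every continuous crossed homomorphism
`f : Γ_{K_v} → E(K̄_v)` with values in the receptacle `E⁰(K̄_v) = E0Receptacle X v` and vanishing on
the inertia group `I_𝔐` is `σ ↦ σ • S − S` for some `S ∈ E⁰(K̄_v)`. (x11b3's
`oneCocycleClass_eq_zero_of_mem_E0Receptacle` gives only `S ∈ E(K̄_v)`; the extra information is
Jetchev's "surjectivity of `E⁰(K_v) → H¹(K_v^{ur}/K_v, E⁰(K_v^{ur})[p^m])`".)
[cite: MilneADT2006, Ch. I Prop. 3.8] [cite: Jetchev2008, Prop. 4.1 (pp. 819–821)]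
[cite: SilvermanAEC2009, VII.5 Prop. 5.1] -/
theorem exists_mem_E0Receptacle_eq_smul_sub (X : WeierstrassCurve K) [X.IsElliptic]
    (v : HeightOneSpectrum (𝓞 K)) (hbad : ¬ X.HasGoodReductionAt v)
    {𝔐 : Ideal v.localAbsIntegers} (h𝔐 : 𝔐 ∈ v.localPrimesAbove)
    (f : contOneCocycles (discreteTopRep (absoluteGaloisGroup (v.adicCompletion K))
      (localPoints X (v.adicCompletion K))))
    (hfB : ∀ τ, f.1 τ ∈ E0Receptacle X v)
    (hfI : ∀ τ ∈ 𝔐.inertia (absoluteGaloisGroup (v.adicCompletion K)), f.1 τ = 0) :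
    ∃ S ∈ E0Receptacle X v, ∀ τ, f.1 τ = τ • S - S := by
  -- the chosen witnesses of the receptacle: `w`, `ι : 𝓞_v → 𝒪_w`, `C` with `C • X_v = M_v`
  have hw := (v.exists_spectralValuation).choose_spec
  have hι := (exists_ringHom_adicCompletionIntegers_integer
    (v.exists_spectralValuation).choose_spec).choose_spec
  have hC := (X.exists_variableChange_eq_localMinimalIntegralModel v).choose_spec
  have hvw : (v.exists_spectralValuation).choose.Integers (v.exists_spectralValuation).choose.integer :=
    Valuation.integer.integers _
  haveI := WeierstrassCurve.isIntegral_spectralValuation_baseChange hw (X.localMinimalIntegralModel v)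
  have hC' := congrArg (fun Y : WeierstrassCurve (v.adicCompletion K) ↦
    Y.baseChange (AlgebraicClosure (v.adicCompletion K))) hC
  have hX := baseChange_map_eq_baseChange_map hι (X.localMinimalIntegralModel v)
  -- the equivariant transport `Φ : E(K̄_v) ≃ V(K̄_v)` of the receptacle
  let Φ : localPoints X (v.adicCompletion K) ≃+
      (((X.localMinimalIntegralModel v).map (algebraMap (v.adicCompletionIntegers K)
        (v.adicCompletion K))).baseChange (AlgebraicClosure (v.adicCompletion K))).toAffine.Point :=
    ((WeierstrassCurve.Affine.Point.congrEquiv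
        (WeierstrassCurve.baseChange_baseChange_adicCompletion X v).symm).trans
      (WeierstrassCurve.VariableChange.pointEquivBaseChange (X.baseChange (v.adicCompletion K))
        (X.exists_variableChange_eq_localMinimalIntegralModel v).choose
        (AlgebraicClosure (v.adicCompletion K)))).trans
      (WeierstrassCurve.Affine.Point.congrEquiv hC')
  have hΦ : ∀ (σ : absoluteGaloisGroup (v.adicCompletion K)) (Q : localPoints X (v.adicCompletion K)),
      Φ (σ • Q) = WeierstrassCurve.Affine.Point.map ((absoluteGaloisGroup.toAlgEquiv (v.adicCompletion K) σ :
          AlgebraicClosure (v.adicCompletion K) ≃ₐ[v.adicCompletion K] AlgebraicClosure (v.adicCompletion K)) :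
          AlgebraicClosure (v.adicCompletion K) →ₐ[v.adicCompletion K] AlgebraicClosure (v.adicCompletion K))
        (Φ Q) := by
    intro σ Q
    change WeierstrassCurve.Affine.Point.congrEquiv hC'
        (WeierstrassCurve.VariableChange.pointEquivBaseChange (X.baseChange (v.adicCompletion K))
          (X.exists_variableChange_eq_localMinimalIntegralModel v).choose
          (AlgebraicClosure (v.adicCompletion K))
          (WeierstrassCurve.Affine.Point.congrEquiv
            (WeierstrassCurve.baseChange_baseChange_adicCompletion X v).symm (σ • Q))) =
      WeierstrassCurve.Affine.Point.map _ (WeierstrassCurve.Affine.Point.congrEquiv hC'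
        (WeierstrassCurve.VariableChange.pointEquivBaseChange (X.baseChange (v.adicCompletion K))
          (X.exists_variableChange_eq_localMinimalIntegralModel v).choose
          (AlgebraicClosure (v.adicCompletion K))
          (WeierstrassCurve.Affine.Point.congrEquiv
            (WeierstrassCurve.baseChange_baseChange_adicCompletion X v).symm Q)))
    rw [WeierstrassCurve.congrEquiv_smul, WeierstrassCurve.VariableChange.pointEquivBaseChange_map_algEquiv]
    exact WeierstrassCurve.Affine.Point.congrEquiv_baseChange_map hC _ _
  -- receptacle membership is nonsingular reduction of the transported point on `W₀ = M.map ι`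
  have hrec : ∀ Q : localPoints X (v.adicCompletion K), Q ∈ E0Receptacle X v ↔
      ((X.localMinimalIntegralModel v).map (exists_ringHom_adicCompletionIntegers_integer
        (v.exists_spectralValuation).choose_spec).choose).HasNonsingularReduction
        (Affine.Point.congrEquiv hX (Φ Q)) :=
    fun Q ↦ mem_E0Receptacle_iff X v Q
  -- the transported crossed homomorphism
  set g : absoluteGaloisGroup (v.adicCompletion K) → _ := fun σ ↦ Φ (f.1 σ) with hgdef
  have hg : ∀ σ τ, g (σ * τ) = g σ + WeierstrassCurve.Affine.Point.map
      ((absoluteGaloisGroup.toAlgEquiv (v.adicCompletion K) σ :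
        AlgebraicClosure (v.adicCompletion K) ≃ₐ[v.adicCompletion K] AlgebraicClosure (v.adicCompletion K)) :
        AlgebraicClosure (v.adicCompletion K) →ₐ[v.adicCompletion K] AlgebraicClosure (v.adicCompletion K)) (g τ) := by
    intro σ τ
    simp only [hgdef]
    rw [f.2 σ τ, map_add, discreteTopRep_ρ_apply, hΦ]
  have hopen : IsOpen {σ | g σ = 0} := by
    have e : {σ | g σ = 0} = f.1 ⁻¹' {0} := by
      ext σ
      simp only [hgdef, Set.mem_setOf_eq, Set.mem_preimage, Set.mem_singleton_iff]
      exact Φ.map_eq_zero_iff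
    rw [e]
    exact (isOpen_discrete _).preimage f.1.continuous
  have hI : ∀ τ ∈ 𝔐.inertia (absoluteGaloisGroup (v.adicCompletion K)), g τ = 0 := fun τ hτ ↦ by
    simp only [hgdef, hfI τ hτ, map_zero]
  have hE₀ : ∀ σ, ((X.localMinimalIntegralModel v).map (exists_ringHom_adicCompletionIntegers_integer
      (v.exists_spectralValuation).choose_spec).choose).HasNonsingularReduction
      (Affine.Point.congrEquiv hX (g σ)) := fun σ ↦ (hrec _).mp (hfB σ)
  -- the subgroup `E₀` on the model side, containing the kernel of reduction
  let B : AddSubgroup (((X.localMinimalIntegralModel v).map (algebraMap (v.adicCompletionIntegers K)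
      (v.adicCompletion K))).baseChange (AlgebraicClosure (v.adicCompletion K))).toAffine.Point :=
    (((X.localMinimalIntegralModel v).map (exists_ringHom_adicCompletionIntegers_integer
      (v.exists_spectralValuation).choose_spec).choose).nonsingularReductionSubgroup hvw).comap
      (Affine.Point.congrEquiv hX).toAddMonoidHom
  have hBmem : ∀ P, P ∈ B ↔ ((X.localMinimalIntegralModel v).map
      (exists_ringHom_adicCompletionIntegers_integer (v.exists_spectralValuation).choose_spec).choose).HasNonsingularReduction
      (Affine.Point.congrEquiv hX P) := fun P ↦ Iff.rfl
  have hB₁ : ∀ Q, Q ∈ kernel (v.exists_spectralValuation).choose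
      (((X.localMinimalIntegralModel v).map (algebraMap (v.adicCompletionIntegers K)
        (v.adicCompletion K))).baseChange (AlgebraicClosure (v.adicCompletion K))) → Q ∈ B := by
    intro Q hQ
    rw [hBmem]
    refine WeierstrassCurve.ReducesToZero.hasNonsingularReduction ?_
    rcases Q with _ | ⟨x, y, h⟩
    · rw [← Affine.Point.zero_def, map_zero]
      exact WeierstrassCurve.reducesToZero_zero
    · rw [Affine.Point.congrEquiv_some, WeierstrassCurve.reducesToZero_some_iff, not_mem_range_iff hvw]
      exact (FormalGroupChart.some_mem_kernel_iff h).mp hQ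
  -- Step 1 of Milne's proof, by reduction type, with the lift IN `E₀`
  have hlift : ∀ φ : absoluteGaloisGroup (v.adicCompletion K),
      (∀ z : AlgebraicClosure (v.adicCompletion K), (v.exists_spectralValuation).choose z ≤ 1 →
        (v.exists_spectralValuation).choose (absoluteGaloisGroup.toAlgEquiv (v.adicCompletion K) φ z -
          z ^ Nat.card (IsLocalRing.ResidueField (v.adicCompletionIntegers K))) < 1) →
      ∃ b : (((X.localMinimalIntegralModel v).map (algebraMap (v.adicCompletionIntegers K)
          (v.adicCompletion K))).baseChange (AlgebraicClosure (v.adicCompletion K))).toAffine.Point,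
        b ∈ B ∧ (∀ τ ∈ 𝔐.inertia (absoluteGaloisGroup (v.adicCompletion K)),
          WeierstrassCurve.Affine.Point.map (W' := (X.localMinimalIntegralModel v).map
            (algebraMap (v.adicCompletionIntegers K) (v.adicCompletion K)))
            ((absoluteGaloisGroup.toAlgEquiv (v.adicCompletion K) τ :
              AlgebraicClosure (v.adicCompletion K) ≃ₐ[v.adicCompletion K] AlgebraicClosure (v.adicCompletion K)) :
              AlgebraicClosure (v.adicCompletion K) →ₐ[v.adicCompletion K] AlgebraicClosure (v.adicCompletion K)) b = b) ∧
        g φ - (WeierstrassCurve.Affine.Point.map (W' := (X.localMinimalIntegralModel v).map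
            (algebraMap (v.adicCompletionIntegers K) (v.adicCompletion K)))
            ((absoluteGaloisGroup.toAlgEquiv (v.adicCompletion K) φ :
              AlgebraicClosure (v.adicCompletion K) ≃ₐ[v.adicCompletion K] AlgebraicClosure (v.adicCompletion K)) :
              AlgebraicClosure (v.adicCompletion K) →ₐ[v.adicCompletion K] AlgebraicClosure (v.adicCompletion K)) b - b)
          ∈ kernel (v.exists_spectralValuation).choose (((X.localMinimalIntegralModel v).map
            (algebraMap (v.adicCompletionIntegers K) (v.adicCompletion K))).baseChange
            (AlgebraicClosure (v.adicCompletion K))) := by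
    intro φ hφq
    rcases hasGoodReductionAt_or_hasMultiplicativeReductionAt_or_hasAdditiveReductionAt v X with
      hgood | hmult | hadd
    · exact absurd hgood hbad
    · obtain ⟨b, hbE, hbI, hb⟩ := exists_lift_sub_mem_kernel_of_hasMultiplicativeReductionAt_mem X hw
        hmult h𝔐 hι hφq (g φ) (hE₀ φ)
      exact ⟨b, (hBmem b).mpr hbE, hbI, hb⟩
    · obtain ⟨b, hbE, hbI, hb⟩ := exists_lift_sub_mem_kernel_of_hasAdditiveReductionAt_mem hw hι X
        hadd h𝔐 hφq (g φ) (hE₀ φ)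
      exact ⟨b, (hBmem b).mpr hbE, hbI, hb⟩
  -- Steps 2–4 with the witness tracked in `B`
  obtain ⟨P, hPB, hP⟩ := exists_mem_eq_map_sub_of_cocycle_of_lift X hw h𝔐 g hg hopen hI B hB₁ hlift
  refine ⟨Φ.symm P, ?_, fun σ ↦ Φ.injective ?_⟩
  · rw [hrec, AddEquiv.apply_symm_apply]
    exact (hBmem P).mp hPB
  · rw [map_sub, hΦ, AddEquiv.apply_symm_apply]
    exact hP σ

end Summit.BirchSwinnertonDyer.Rank1Residual.JET.StrongMilne

end
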